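import Summits.AnomalousDissipation.AnomalousDissipation.Theorems.SawtoothPulseCascadeLipAgmonResponseSlot
import Summits.AnomalousDissipation.AnomalousDissipation.Theorems.SawtoothPulseCascadeLipAgmonCascadeShear
import Summits.AnomalousDissipation.AnomalousDissipation.Theorems.SawtoothPulseCascadeApproxSlotStep
import Literature.Analysis.FluidPDE.SawtoothCascadeProfileCurvature
import HarnessLib

/-!
# The cascade response over one half pulse, in the form consumed by the phase recursion
(route `AnomalousDissipation/SawtoothPulseCascade`, line `lip-agmon` of the crux ApproxSol58 =
stmt-AnomalousDissipation-19688; lead g4, module E-concrete, part 3)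

`response_slot_bounds` (p505460) specialised to the H and V half-slots of the sawtooth cascade
(shear structure: `…LipAgmonCascadeShear` p501341; `‖∇Ω̄‖ ≤ rate·2√(2π)N_j/δ_j`:
`norm_gradient_vorticity_field_le_of_mem_H/V`, p493655), with the remaining PROFILE CAPS as explicit
hypotheses (`|∂∂Ω̄| ≤ rate·κ₂`, `|∂∂∂Ω̄| ≤ rate·κ₃`, and the three `L²` sizes of the curl of the heat-lag force
`νΔū` — these are `c_m (N_j/δ_j)^{m−1}`-type bounds on `U_j⁽ᵐ⁾`, `m ≤ 5`, to be supplied by the Literature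
side), and the natural aggregate output MASSAGED into the monomial shape of `phase_bounds` (p503896):
`natural_le_phaseForm` (pure real arithmetic: constants `C₂ = 2c₂`, `C₃ = (2√2(2+γ) + 4√2 + 1)c₃`,
`C₄ = (15+γ)c₄ + 2√2c₂c₃`, `C₅ = 4c₅ + c₂c₄`).
-/

set_option linter.dupNamespace false

noncomputable section

namespace Summit.AnomalousDissipation.AnomalousDissipation.Theorems.SawtoothPulseCascade.LipAgmon

open Set MeasureTheory intervalIntegral
open scoped InnerProductSpace ContDiff
open Literature.Analysis Literature.Analysis.FunctionSpaces Literature.Analysis.FluidPDE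
open Literature.Analysis.FluidPDE.Torus Literature.Analysis.FunctionSpaces.Torus
open Literature.Analysis.FluidPDE.SawtoothCascade Literature.Analysis.FluidPDE.SawtoothCascade.CascadeParams

/-! ## §1 Natural aggregate form ⇒ the monomial form of `phase_bounds` -/

/-- **Massaging lemma** (pure arithmetic). The natural per-half-pulse bounds of `response_slot_bounds`
with the cascade scalings `κ₁ = c₂s`, `κ₂ = c₃s²`, `κ₃ = c₄s³`, `λ₀ = νc₃s²`, `λ₁ = νc₄s³`, `λ₂ = νc₅s⁴`
imply the hypotheses `hst0/hst1/hst2` of `phase_bounds` with the constants `C₂ = 2c₂`,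
`C₃ = (2√2(2+γ) + 4√2 + 1)c₃`, `C₄ = (15+γ)c₄ + 2√2c₂c₃`, `C₅ = 4c₅ + c₂c₄` (all monomials dominated
term by term; `γ² ≤ (1+γ+γ²)γ`). [folklore] -/
theorem natural_le_phaseForm {γ c₂ c₃ c₄ c₅ ν s e z₀ S₁₀ S₂₀ W₀ zt S₁t S₂t C₂ C₃ C₄ C₅ Zp Sp : ℝ}
    (hγ : 0 ≤ γ) (hc₂ : 0 ≤ c₂) (hc₃ : 0 ≤ c₃) (hc₄ : 0 ≤ c₄) (hc₅ : 0 ≤ c₅) (hν : 0 ≤ ν) (hs : 0 ≤ s)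
    (he : 0 ≤ e) (hz₀ : 0 ≤ z₀) (hS₁₀ : 0 ≤ S₁₀) (hW : W₀ ≤ S₁₀)
    (hC₂ : C₂ = 2 * c₂) (hC₃ : C₃ = (2 * Real.sqrt 2 * (2 + γ) + 4 * Real.sqrt 2 + 1) * c₃)
    (hC₄ : C₄ = (15 + γ) * c₄ + 2 * Real.sqrt 2 * c₂ * c₃) (hC₅ : C₅ = 4 * c₅ + c₂ * c₄)
    (hZp : Zp = z₀ + γ * s * (C₂ * e + C₃ * ν * s))
    (hSp : Sp = (1 + γ) * S₁₀ + γ * (1 + γ) * C₂ * s * Zp + γ * (C₃ * s ^ 2 * e + C₂ * s * Zp + C₄ * ν * s ^ 3))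
    (h0 : zt ≤ z₀ + γ * (ν * c₃ * s ^ 2 + c₂ * s * e))
    (h1 : S₁t ≤ (1 + γ) * S₁₀ + (2 + γ) * γ * (ν * c₄ * s ^ 3 +
      2 * (c₂ * s * (z₀ + γ * (ν * c₃ * s ^ 2 + c₂ * s * e)) + Real.sqrt 2 * (c₃ * s ^ 2) * e)))
    (h2 : S₂t ≤ (1 + γ + γ ^ 2) * (S₂₀ + 3 * γ * (ν * c₅ * s ^ 4 + 2 * (c₂ * s *
        ((1 + γ) * S₁₀ + (2 + γ) * γ * (ν * c₄ * s ^ 3 +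
          2 * (c₂ * s * (z₀ + γ * (ν * c₃ * s ^ 2 + c₂ * s * e)) + Real.sqrt 2 * (c₃ * s ^ 2) * e))) +
        2 * Real.sqrt 2 * (c₃ * s ^ 2) * (z₀ + γ * (ν * c₃ * s ^ 2 + c₂ * s * e)) + 2 * (c₄ * s ^ 3) * e))) +
      γ * (c₂ * s) * (W₀ + γ * (ν * c₄ * s ^ 3 +
        2 * (c₂ * s * (z₀ + γ * (ν * c₃ * s ^ 2 + c₂ * s * e)) + Real.sqrt 2 * (c₃ * s ^ 2) * e)))) :
    zt ≤ Zp ∧ S₁t ≤ Sp ∧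
    S₂t ≤ (1 + γ + γ ^ 2) * (S₂₀ + γ * C₂ * s * Sp + γ * (C₃ * s ^ 2 * Zp + C₂ * s * Sp) +
        γ * (C₄ * s ^ 3 * e + 2 * C₃ * s ^ 2 * Zp + C₂ * s * Sp + C₅ * ν * s ^ 4)) +
      γ * C₂ * s * (S₁₀ + γ * C₂ * s * Zp) := by
  have h2r : 0 ≤ Real.sqrt 2 := Real.sqrt_nonneg _
  -- the natural intermediate sizes
  obtain ⟨ZN, hZN⟩ : ∃ x : ℝ, x = z₀ + γ * (ν * c₃ * s ^ 2 + c₂ * s * e) := ⟨_, rfl⟩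
  obtain ⟨SN, hSN⟩ : ∃ x : ℝ, x = (1 + γ) * S₁₀ + (2 + γ) * γ * (ν * c₄ * s ^ 3 +
      2 * (c₂ * s * (z₀ + γ * (ν * c₃ * s ^ 2 + c₂ * s * e)) + Real.sqrt 2 * (c₃ * s ^ 2) * e)) := ⟨_, rfl⟩
  rw [← hZN] at hSN
  rw [← hZN] at h0 h1 h2
  rw [← hSN] at h1 h2
  have hZN0 : 0 ≤ ZN := by rw [hZN]; positivity
  have hC₃0 : 0 ≤ C₃ := by rw [hC₃]; positivity
  have hZp0 : 0 ≤ Zp := by rw [hZp, hC₂]; positivity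
  have hSN0 : 0 ≤ SN := by rw [hSN]; positivity
  -- `ZN ≤ Zp`
  have hZle : ZN ≤ Zp := by
    rw [hZN, hZp, hC₂, hC₃]
    have n1 : 0 ≤ γ * c₂ * s * e := by positivity
    have n2 : 0 ≤ γ * Real.sqrt 2 * c₃ * ν * s ^ 2 := by positivity
    have n3 : 0 ≤ γ * γ * Real.sqrt 2 * c₃ * ν * s ^ 2 := by positivity
    linarith [n1, n2, n3]
  -- level 1: `SN ≤ Sp`
  have hSle : SN ≤ Sp := by
    rw [hSN, hSp, hC₂, hC₃, hC₄]
    have a1 := mul_le_mul_of_nonneg_left hZle (show 0 ≤ (2 + γ) * γ * 2 * c₂ * s by positivity)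
    have n1 : 0 ≤ γ * c₄ * ν * s ^ 3 := by positivity
    have n2 : 0 ≤ γ * Real.sqrt 2 * c₂ * c₃ * ν * s ^ 3 := by positivity
    have n3 : 0 ≤ Real.sqrt 2 * γ * c₃ * s ^ 2 * e := by positivity
    have n4 : 0 ≤ γ * c₃ * s ^ 2 * e := by positivity
    linarith [a1, n1, n2, n3, n4]
  refine ⟨h0.trans hZle, h1.trans hSle, h2.trans ?_⟩
  -- level 2
  have hT : 0 ≤ 1 + γ + γ ^ 2 := by positivity
  have hγT : γ ^ 2 ≤ (1 + γ + γ ^ 2) * γ := by nlinarith [sq_nonneg γ, mul_nonneg hγ (sq_nonneg γ)]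
  have hSp0 : 0 ≤ Sp := hSN0.trans hSle
  have q1 := mul_le_mul_of_nonneg_left hSle (show 0 ≤ (1 + γ + γ ^ 2) * γ * 6 * c₂ * s by positivity)
  have q2 := mul_le_mul_of_nonneg_left hZle
    (show 0 ≤ (1 + γ + γ ^ 2) * γ * 12 * Real.sqrt 2 * c₃ * s ^ 2 by positivity)
  have q3 := mul_le_mul_of_nonneg_left hW (show 0 ≤ γ * c₂ * s by positivity)
  have q4 := mul_le_mul_of_nonneg_left hZle (show 0 ≤ 2 * γ ^ 2 * c₂ ^ 2 * s ^ 2 by positivity)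
  have q5 := mul_le_mul_of_nonneg_right hγT (show 0 ≤ 2 * Real.sqrt 2 * c₂ * c₃ * s ^ 3 * e by positivity)
  have q6 := mul_le_mul_of_nonneg_right hγT (show 0 ≤ c₂ * c₄ * ν * s ^ 4 by positivity)
  -- slack (nonnegative leftover) terms
  have n1 : 0 ≤ (1 + γ + γ ^ 2) * γ * (c₃ * s ^ 2 * Zp) := by positivity
  have n2 : 0 ≤ (1 + γ + γ ^ 2) * γ * (c₄ * s ^ 3 * e) := by positivity
  have n3 : 0 ≤ (1 + γ + γ ^ 2) * γ * (c₅ * ν * s ^ 4) := by positivity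
  have n4 : 0 ≤ (1 + γ + γ ^ 2) * γ * (γ * c₄ * s ^ 3 * e) := by positivity
  have n5 : 0 ≤ (1 + γ + γ ^ 2) * γ * (Real.sqrt 2 * γ * c₃ * s ^ 2 * Zp) := by positivity
  have n6 : 0 ≤ (1 + γ + γ ^ 2) * γ * (Real.sqrt 2 * c₃ * s ^ 2 * Zp) := by positivity
  have n7 : 0 ≤ γ * c₂ * s * S₁₀ := by positivity
  have n8 : 0 ≤ γ ^ 2 * c₂ ^ 2 * s ^ 2 * Zp := by positivity
  rw [hC₂, hC₃, hC₄, hC₅]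
  linarith [q1, q2, q3, q4, q5, q6, n1, n2, n3, n4, n5, n6, n7, n8]


/-! ## §2 The cascade response on an H half-slot and on a V half-slot -/


/-- **The cascade response over the H half pulse of phase `j` (levels 0, 1, 2, natural form).**
For the classical linearised response `(L, q)` of the cascade (`∂ₜL + (ū·∇)L + (L·∇)ū = νΔL − ∇q + νΔū` on
`[0, T']`, `T' ≥` the slot end) with `‖L(τ)‖₂ ≤ e` on the slot, and profile caps on the slot
(`|∂∂Ω̄| ≤ rate·κ₂`, `|∂∂∂Ω̄| ≤ rate·κ₃`, `L²` sizes of the curl of `νΔū` and of its first/second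
derivatives `≤ rate·λ₀, rate·λ₁, rate·λ₂`): the conclusions of `response_slot_bounds` with streamwise index
`0`, cross index `1`, `Γ = γ`, `κ₁ = 2√(2π)·N_j/δ_j` (`…LipAgmonCascadeShear`,
`norm_gradient_vorticity_field_le_of_mem_H`). [cite: MajdaBertozzi2002, §3.2 Prop. 3.7 (energy estimates for derivatives, uniform in the viscosity)] -/
theorem cascade_slot_H (P : CascadeParams) (hγ1 : 1 ≤ P.γ) (hδ₀ : 0 < P.δ₀) (hd : 0 < P.d)
    {ν T' : ℝ} (hν : 0 ≤ ν) {j : ℕ} (hjT : CascadeParams.tStart j + CascadeParams.tHalf j ≤ T')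
    {L : ℝ → UnitAddTorus (Fin 2) → EuclideanSpace ℝ (Fin 2)} {q : ℝ → UnitAddTorus (Fin 2) → ℝ}
    (hL : Torus.IsSmoothSpaceTimeOn (Icc 0 T') L) (hq : Torus.IsSmoothSpaceTimeOn (Icc 0 T') q)
    (hdiv : ∀ t ∈ Icc 0 T', Torus.IsDivFree (L t))
    (hlin : ∀ t ∈ Icc 0 T', ∀ x, Torus.timeDerivWithin (Icc 0 T') L t x + Torus.convect (P.field t) (L t) x +
      Torus.convect (L t) (P.field t) x =
        ν • Torus.laplacian (L t) x - Torus.gradient (q t) x + ν • Torus.laplacian (P.field t) x)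
    {κ₂ κ₃ lam₀ lam₁ lam₂ e : ℝ} (hκ₂ : 0 ≤ κ₂) (hκ₃ : 0 ≤ κ₃) (hl₀ : 0 ≤ lam₀) (hl₁ : 0 ≤ lam₁)
    (hl₂ : 0 ≤ lam₂) (he0 : 0 ≤ e)
    (hΩ2 : ∀ t ∈ Icc (CascadeParams.tStart j) (CascadeParams.tStart j + CascadeParams.tHalf j), ∀ x i m,
      |Torus.partialDeriv i (Torus.partialDeriv m (torusVorticityTensor (P.field t) 0 1)) x| ≤ P.rateH j t * κ₂)
    (hΩ3 : ∀ t ∈ Icc (CascadeParams.tStart j) (CascadeParams.tStart j + CascadeParams.tHalf j), ∀ x i l m,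
      |Torus.partialDeriv i (Torus.partialDeriv l (Torus.partialDeriv m (torusVorticityTensor (P.field t) 0 1))) x| ≤
        P.rateH j t * κ₃)
    (hc0 : ∀ t ∈ Icc (CascadeParams.tStart j) (CascadeParams.tStart j + CascadeParams.tHalf j),
      Real.sqrt (∫ x, (Torus.partialDeriv 0 (fun y => ν • Torus.laplacian (P.field t) y) x 1 -
        Torus.partialDeriv 1 (fun y => ν • Torus.laplacian (P.field t) y) x 0) ^ 2) ≤ P.rateH j t * lam₀)
    (hc1 : ∀ t ∈ Icc (CascadeParams.tStart j) (CascadeParams.tStart j + CascadeParams.tHalf j),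
      Real.sqrt (scalarGradNormSq (fun x => Torus.partialDeriv 0 (fun y => ν • Torus.laplacian (P.field t) y) x 1 -
        Torus.partialDeriv 1 (fun y => ν • Torus.laplacian (P.field t) y) x 0)) ≤ P.rateH j t * lam₁)
    (hc2 : ∀ t ∈ Icc (CascadeParams.tStart j) (CascadeParams.tStart j + CascadeParams.tHalf j),
      Real.sqrt (∑ i, ∑ m, ∫ x, (Torus.partialDeriv i (Torus.partialDeriv m
        (fun x => Torus.partialDeriv 0 (fun y => ν • Torus.laplacian (P.field t) y) x 1 -
          Torus.partialDeriv 1 (fun y => ν • Torus.laplacian (P.field t) y) x 0)) x) ^ 2) ≤ P.rateH j t * lam₂)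
    (he : ∀ t ∈ Icc (CascadeParams.tStart j) (CascadeParams.tStart j + CascadeParams.tHalf j), Real.sqrt (∫ x, ‖L t x‖ ^ 2) ≤ e)
    {t : ℝ} (ht : t ∈ Icc (CascadeParams.tStart j) (CascadeParams.tStart j + CascadeParams.tHalf j)) :
    -- level 0
    Real.sqrt (∫ x, torusVorticityTensor (L t) 0 1 x ^ 2) ≤
        Real.sqrt (∫ x, torusVorticityTensor (L (CascadeParams.tStart j)) 0 1 x ^ 2) + P.γ * (lam₀ + (2 * Real.sqrt (2 * Real.pi) * ((P.N j : ℝ) / P.δ j)) * e) ∧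
    -- level 1
    Real.sqrt (∫ x, (Torus.partialDeriv 0 (torusVorticityTensor (L t) 0 1) x) ^ 2) +
        Real.sqrt (∫ x, (Torus.partialDeriv 1 (torusVorticityTensor (L t) 0 1) x) ^ 2) ≤
      (1 + P.γ) * (Real.sqrt (∫ x, (Torus.partialDeriv 0 (torusVorticityTensor (L (CascadeParams.tStart j)) 0 1) x) ^ 2) +
          Real.sqrt (∫ x, (Torus.partialDeriv 1 (torusVorticityTensor (L (CascadeParams.tStart j)) 0 1) x) ^ 2)) +
        (2 + P.γ) * P.γ * (lam₁ + 2 * ((2 * Real.sqrt (2 * Real.pi) * ((P.N j : ℝ) / P.δ j)) * (Real.sqrt (∫ x, torusVorticityTensor (L (CascadeParams.tStart j)) 0 1 x ^ 2) + P.γ * (lam₀ + (2 * Real.sqrt (2 * Real.pi) * ((P.N j : ℝ) / P.δ j)) * e)) +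
          Real.sqrt 2 * κ₂ * e)) ∧
    -- level 2
    Real.sqrt (∫ x, (Torus.partialDeriv 0 (Torus.partialDeriv 0 (torusVorticityTensor (L t) 0 1)) x) ^ 2) +
        Real.sqrt (∫ x, (Torus.partialDeriv 0 (Torus.partialDeriv 1 (torusVorticityTensor (L t) 0 1)) x) ^ 2) +
        Real.sqrt (∫ x, (Torus.partialDeriv 1 (Torus.partialDeriv 1 (torusVorticityTensor (L t) 0 1)) x) ^ 2) ≤
      (1 + P.γ + P.γ ^ 2) *
          (Real.sqrt (∫ x, (Torus.partialDeriv 0 (Torus.partialDeriv 0 (torusVorticityTensor (L (CascadeParams.tStart j)) 0 1)) x) ^ 2) +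
            Real.sqrt (∫ x, (Torus.partialDeriv 0 (Torus.partialDeriv 1 (torusVorticityTensor (L (CascadeParams.tStart j)) 0 1)) x) ^ 2) +
            Real.sqrt (∫ x, (Torus.partialDeriv 1 (Torus.partialDeriv 1 (torusVorticityTensor (L (CascadeParams.tStart j)) 0 1)) x) ^ 2) +
            3 * P.γ * (lam₂ + 2 * ((2 * Real.sqrt (2 * Real.pi) * ((P.N j : ℝ) / P.δ j)) *
              ((1 + P.γ) * (Real.sqrt (∫ x, (Torus.partialDeriv 0 (torusVorticityTensor (L (CascadeParams.tStart j)) 0 1) x) ^ 2) +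
                  Real.sqrt (∫ x, (Torus.partialDeriv 1 (torusVorticityTensor (L (CascadeParams.tStart j)) 0 1) x) ^ 2)) +
                (2 + P.γ) * P.γ * (lam₁ + 2 * ((2 * Real.sqrt (2 * Real.pi) * ((P.N j : ℝ) / P.δ j)) * (Real.sqrt (∫ x, torusVorticityTensor (L (CascadeParams.tStart j)) 0 1 x ^ 2) +
                  P.γ * (lam₀ + (2 * Real.sqrt (2 * Real.pi) * ((P.N j : ℝ) / P.δ j)) * e)) + Real.sqrt 2 * κ₂ * e))) +
              2 * Real.sqrt 2 * κ₂ * (Real.sqrt (∫ x, torusVorticityTensor (L (CascadeParams.tStart j)) 0 1 x ^ 2) + P.γ * (lam₀ + (2 * Real.sqrt (2 * Real.pi) * ((P.N j : ℝ) / P.δ j)) * e)) +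
              2 * κ₃ * e))) +
        P.γ * (2 * Real.sqrt (2 * Real.pi) * ((P.N j : ℝ) / P.δ j)) * (Real.sqrt (∫ x, (Torus.partialDeriv 0 (torusVorticityTensor (L (CascadeParams.tStart j)) 0 1) x) ^ 2) +
          P.γ * (lam₁ + 2 * ((2 * Real.sqrt (2 * Real.pi) * ((P.N j : ℝ) / P.δ j)) * (Real.sqrt (∫ x, torusVorticityTensor (L (CascadeParams.tStart j)) 0 1 x ^ 2) + P.γ * (lam₀ + (2 * Real.sqrt (2 * Real.pi) * ((P.N j : ℝ) / P.δ j)) * e)) +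
            Real.sqrt 2 * κ₂ * e))) := by
  have hγ0 : 0 ≤ P.γ := zero_le_one.trans hγ1
  have hδ : 0 < P.δ j := P.δ_pos hδ₀ hd j
  have hab : CascadeParams.tStart j < CascadeParams.tStart j + CascadeParams.tHalf j := by
    linarith [CascadeParams.tHalf_pos j]
  have ha0 : (0 : ℝ) ≤ CascadeParams.tStart j := by
    exact CascadeParams.tStart_nonneg j
  have hsub : Icc (CascadeParams.tStart j) (CascadeParams.tStart j + CascadeParams.tHalf j) ⊆ Icc 0 T' := fun s hs => ⟨ha0.trans hs.1, hs.2.trans hjT⟩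
  have hu : Torus.IsSmoothSpaceTimeOn (Icc (CascadeParams.tStart j) (CascadeParams.tStart j + CascadeParams.tHalf j)) P.field :=
    P.isSmoothSpaceTimeOn_field_of_subset_H hδ₀ hd Subset.rfl
  have hudiv : ∀ t ∈ Icc (CascadeParams.tStart j) (CascadeParams.tStart j + CascadeParams.tHalf j), Torus.IsDivFree (P.field t) := fun t ht => P.isDivFree_field_of_mem_H ht
  have hw := hL.mono hsub
  have hq' := hq.mono hsub
  have hwdiv : ∀ t ∈ Icc (CascadeParams.tStart j) (CascadeParams.tStart j + CascadeParams.tHalf j), Torus.IsDivFree (L t) := fun t ht => hdiv t (hsub ht)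
  have hlin' : ∀ t ∈ Icc (CascadeParams.tStart j) (CascadeParams.tStart j + CascadeParams.tHalf j), ∀ x, Torus.timeDerivWithin (Icc (CascadeParams.tStart j) (CascadeParams.tStart j + CascadeParams.tHalf j)) L t x +
      Torus.convect (P.field t) (L t) x + Torus.convect (L t) (P.field t) x =
        ν • Torus.laplacian (L t) x - Torus.gradient (q t) x + (fun t y => ν • Torus.laplacian (P.field t) y) t x := by
    intro t ht x
    rw [ApproxResponse.timeDerivWithin_Icc_eq_of_subset hab hsub hL ht x]
    exact hlin t (hsub ht) x
  -- shear structure and caps with `κ₁ = 2√(2π)·(N_j/δ_j)`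
  have eκ : P.rateH j t = P.rateH j t := rfl
  have hκ₁0 : 0 ≤ 2 * Real.sqrt (2 * Real.pi) * ((P.N j : ℝ) / P.δ j) := by positivity
  have ek : ∀ r : ℝ, r * (2 * Real.sqrt (2 * Real.pi) * P.N j / P.δ j) =
      r * (2 * Real.sqrt (2 * Real.pi) * ((P.N j : ℝ) / P.δ j)) := fun r => by ring
  have hu0 : ∀ t ∈ Icc (CascadeParams.tStart j) (CascadeParams.tStart j + CascadeParams.tHalf j), ∀ x, Torus.partialDeriv 0 (P.field t) x = 0 :=
    fun t ht x => partialDeriv_zero_field_H P ht x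
  have hu1 : ∀ t ∈ Icc (CascadeParams.tStart j) (CascadeParams.tStart j + CascadeParams.tHalf j), ∀ x (v : EuclideanSpace ℝ (Fin 2)),
      |⟪Torus.partialDeriv 1 (P.field t) x, v⟫_ℝ| ≤ P.rateH j t * |v 0| :=
    fun t ht x v => abs_inner_partialDeriv_one_field_H P hγ0 hδ ht x v
  have hu2 : ∀ t ∈ Icc (CascadeParams.tStart j) (CascadeParams.tStart j + CascadeParams.tHalf j), ∀ x (v : EuclideanSpace ℝ (Fin 2)),
      |⟪Torus.partialDeriv 1 (Torus.partialDeriv 1 (P.field t)) x, v⟫_ℝ| ≤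
        (P.rateH j t * (2 * Real.sqrt (2 * Real.pi) * ((P.N j : ℝ) / P.δ j))) * |v 0| := by
    intro t ht x v
    rw [← ek]
    exact abs_inner_partialDeriv_one_one_field_H P hγ0 hδ ht x v
  have hΩg : ∀ t ∈ Icc (CascadeParams.tStart j) (CascadeParams.tStart j + CascadeParams.tHalf j), ∀ x,
      ‖Torus.gradient (torusVorticityTensor (P.field t) 0 1) x‖ ≤ P.rateH j t * (2 * Real.sqrt (2 * Real.pi) * ((P.N j : ℝ) / P.δ j)) := by
    intro t ht x
    rw [← ek]
    exact P.norm_gradient_vorticity_field_le_of_mem_H hγ0 hδ ht (P.abs_deriv_deriv_U_le hδ) x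
  have hΩ1 : ∀ t ∈ Icc (CascadeParams.tStart j) (CascadeParams.tStart j + CascadeParams.tHalf j), ∀ x m,
      |Torus.partialDeriv m (torusVorticityTensor (P.field t) 0 1) x| ≤ P.rateH j t * (2 * Real.sqrt (2 * Real.pi) * ((P.N j : ℝ) / P.δ j)) := by
    intro t ht x m
    have hΩt : IsSmooth (torusVorticityTensor (P.field t) 0 1) :=
      (isSmoothSpaceTimeOn_torusVorticityTensor hu hab 0 1).isSmooth_slice ht
    exact (abs_partialDeriv_le_norm_gradient (hΩt.isContDiff (by simp)) x m).trans (hΩg t ht x)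
  have hΓ : ∀ t ∈ Icc (CascadeParams.tStart j) (CascadeParams.tStart j + CascadeParams.tHalf j), ∫ τ in (CascadeParams.tStart j)..t, P.rateH j τ ≤ P.γ := fun t ht => P.integral_rateH_le hγ0 ht
  exact response_slot_bounds hab hν hu hudiv hw hq' hwdiv hlin' (k := 0) (k' := 1) (by decide) (P.continuous_rateH j)
    (fun τ _ => P.rateH_nonneg hγ0 j τ) hγ1 hΓ hκ₁0 hκ₂ hκ₃ hl₀ hl₁ hl₂ he0 hu0 hu1 hu2 hΩg hΩ1 hΩ2 hΩ3
    hc0 hc1 hc2 he ht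

/-- **The cascade response over the V half pulse of phase `j` (levels 0, 1, 2, natural form).**
For the classical linearised response `(L, q)` of the cascade (`∂ₜL + (ū·∇)L + (L·∇)ū = νΔL − ∇q + νΔū` on
`[0, T']`, `T' ≥` the slot end) with `‖L(τ)‖₂ ≤ e` on the slot, and profile caps on the slot
(`|∂∂Ω̄| ≤ rate·κ₂`, `|∂∂∂Ω̄| ≤ rate·κ₃`, `L²` sizes of the curl of `νΔū` and of its first/second
derivatives `≤ rate·λ₀, rate·λ₁, rate·λ₂`): the conclusions of `response_slot_bounds` with streamwise index
`1`, cross index `0`, `Γ = γ`, `κ₁ = 2√(2π)·N_j/δ_j` (`…LipAgmonCascadeShear`,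
`norm_gradient_vorticity_field_le_of_mem_V`). [cite: MajdaBertozzi2002, §3.2 Prop. 3.7 (energy estimates for derivatives, uniform in the viscosity)] -/
theorem cascade_slot_V (P : CascadeParams) (hγ1 : 1 ≤ P.γ) (hδ₀ : 0 < P.δ₀) (hd : 0 < P.d)
    {ν T' : ℝ} (hν : 0 ≤ ν) {j : ℕ} (hjT : CascadeParams.tStart (j + 1) ≤ T')
    {L : ℝ → UnitAddTorus (Fin 2) → EuclideanSpace ℝ (Fin 2)} {q : ℝ → UnitAddTorus (Fin 2) → ℝ}
    (hL : Torus.IsSmoothSpaceTimeOn (Icc 0 T') L) (hq : Torus.IsSmoothSpaceTimeOn (Icc 0 T') q)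
    (hdiv : ∀ t ∈ Icc 0 T', Torus.IsDivFree (L t))
    (hlin : ∀ t ∈ Icc 0 T', ∀ x, Torus.timeDerivWithin (Icc 0 T') L t x + Torus.convect (P.field t) (L t) x +
      Torus.convect (L t) (P.field t) x =
        ν • Torus.laplacian (L t) x - Torus.gradient (q t) x + ν • Torus.laplacian (P.field t) x)
    {κ₂ κ₃ lam₀ lam₁ lam₂ e : ℝ} (hκ₂ : 0 ≤ κ₂) (hκ₃ : 0 ≤ κ₃) (hl₀ : 0 ≤ lam₀) (hl₁ : 0 ≤ lam₁)
    (hl₂ : 0 ≤ lam₂) (he0 : 0 ≤ e)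
    (hΩ2 : ∀ t ∈ Icc (CascadeParams.tStart j + CascadeParams.tHalf j) (CascadeParams.tStart (j + 1)), ∀ x i m,
      |Torus.partialDeriv i (Torus.partialDeriv m (torusVorticityTensor (P.field t) 0 1)) x| ≤ P.rateV j t * κ₂)
    (hΩ3 : ∀ t ∈ Icc (CascadeParams.tStart j + CascadeParams.tHalf j) (CascadeParams.tStart (j + 1)), ∀ x i l m,
      |Torus.partialDeriv i (Torus.partialDeriv l (Torus.partialDeriv m (torusVorticityTensor (P.field t) 0 1))) x| ≤
        P.rateV j t * κ₃)
    (hc0 : ∀ t ∈ Icc (CascadeParams.tStart j + CascadeParams.tHalf j) (CascadeParams.tStart (j + 1)),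
      Real.sqrt (∫ x, (Torus.partialDeriv 0 (fun y => ν • Torus.laplacian (P.field t) y) x 1 -
        Torus.partialDeriv 1 (fun y => ν • Torus.laplacian (P.field t) y) x 0) ^ 2) ≤ P.rateV j t * lam₀)
    (hc1 : ∀ t ∈ Icc (CascadeParams.tStart j + CascadeParams.tHalf j) (CascadeParams.tStart (j + 1)),
      Real.sqrt (scalarGradNormSq (fun x => Torus.partialDeriv 0 (fun y => ν • Torus.laplacian (P.field t) y) x 1 -
        Torus.partialDeriv 1 (fun y => ν • Torus.laplacian (P.field t) y) x 0)) ≤ P.rateV j t * lam₁)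
    (hc2 : ∀ t ∈ Icc (CascadeParams.tStart j + CascadeParams.tHalf j) (CascadeParams.tStart (j + 1)),
      Real.sqrt (∑ i, ∑ m, ∫ x, (Torus.partialDeriv i (Torus.partialDeriv m
        (fun x => Torus.partialDeriv 0 (fun y => ν • Torus.laplacian (P.field t) y) x 1 -
          Torus.partialDeriv 1 (fun y => ν • Torus.laplacian (P.field t) y) x 0)) x) ^ 2) ≤ P.rateV j t * lam₂)
    (he : ∀ t ∈ Icc (CascadeParams.tStart j + CascadeParams.tHalf j) (CascadeParams.tStart (j + 1)), Real.sqrt (∫ x, ‖L t x‖ ^ 2) ≤ e)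
    {t : ℝ} (ht : t ∈ Icc (CascadeParams.tStart j + CascadeParams.tHalf j) (CascadeParams.tStart (j + 1))) :
    -- level 0
    Real.sqrt (∫ x, torusVorticityTensor (L t) 0 1 x ^ 2) ≤
        Real.sqrt (∫ x, torusVorticityTensor (L (CascadeParams.tStart j + CascadeParams.tHalf j)) 0 1 x ^ 2) + P.γ * (lam₀ + (2 * Real.sqrt (2 * Real.pi) * ((P.N j : ℝ) / P.δ j)) * e) ∧
    -- level 1
    Real.sqrt (∫ x, (Torus.partialDeriv 1 (torusVorticityTensor (L t) 0 1) x) ^ 2) +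
        Real.sqrt (∫ x, (Torus.partialDeriv 0 (torusVorticityTensor (L t) 0 1) x) ^ 2) ≤
      (1 + P.γ) * (Real.sqrt (∫ x, (Torus.partialDeriv 1 (torusVorticityTensor (L (CascadeParams.tStart j + CascadeParams.tHalf j)) 0 1) x) ^ 2) +
          Real.sqrt (∫ x, (Torus.partialDeriv 0 (torusVorticityTensor (L (CascadeParams.tStart j + CascadeParams.tHalf j)) 0 1) x) ^ 2)) +
        (2 + P.γ) * P.γ * (lam₁ + 2 * ((2 * Real.sqrt (2 * Real.pi) * ((P.N j : ℝ) / P.δ j)) * (Real.sqrt (∫ x, torusVorticityTensor (L (CascadeParams.tStart j + CascadeParams.tHalf j)) 0 1 x ^ 2) + P.γ * (lam₀ + (2 * Real.sqrt (2 * Real.pi) * ((P.N j : ℝ) / P.δ j)) * e)) +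
          Real.sqrt 2 * κ₂ * e)) ∧
    -- level 2
    Real.sqrt (∫ x, (Torus.partialDeriv 1 (Torus.partialDeriv 1 (torusVorticityTensor (L t) 0 1)) x) ^ 2) +
        Real.sqrt (∫ x, (Torus.partialDeriv 1 (Torus.partialDeriv 0 (torusVorticityTensor (L t) 0 1)) x) ^ 2) +
        Real.sqrt (∫ x, (Torus.partialDeriv 0 (Torus.partialDeriv 0 (torusVorticityTensor (L t) 0 1)) x) ^ 2) ≤
      (1 + P.γ + P.γ ^ 2) *
          (Real.sqrt (∫ x, (Torus.partialDeriv 1 (Torus.partialDeriv 1 (torusVorticityTensor (L (CascadeParams.tStart j + CascadeParams.tHalf j)) 0 1)) x) ^ 2) +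
            Real.sqrt (∫ x, (Torus.partialDeriv 1 (Torus.partialDeriv 0 (torusVorticityTensor (L (CascadeParams.tStart j + CascadeParams.tHalf j)) 0 1)) x) ^ 2) +
            Real.sqrt (∫ x, (Torus.partialDeriv 0 (Torus.partialDeriv 0 (torusVorticityTensor (L (CascadeParams.tStart j + CascadeParams.tHalf j)) 0 1)) x) ^ 2) +
            3 * P.γ * (lam₂ + 2 * ((2 * Real.sqrt (2 * Real.pi) * ((P.N j : ℝ) / P.δ j)) *
              ((1 + P.γ) * (Real.sqrt (∫ x, (Torus.partialDeriv 1 (torusVorticityTensor (L (CascadeParams.tStart j + CascadeParams.tHalf j)) 0 1) x) ^ 2) +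
                  Real.sqrt (∫ x, (Torus.partialDeriv 0 (torusVorticityTensor (L (CascadeParams.tStart j + CascadeParams.tHalf j)) 0 1) x) ^ 2)) +
                (2 + P.γ) * P.γ * (lam₁ + 2 * ((2 * Real.sqrt (2 * Real.pi) * ((P.N j : ℝ) / P.δ j)) * (Real.sqrt (∫ x, torusVorticityTensor (L (CascadeParams.tStart j + CascadeParams.tHalf j)) 0 1 x ^ 2) +
                  P.γ * (lam₀ + (2 * Real.sqrt (2 * Real.pi) * ((P.N j : ℝ) / P.δ j)) * e)) + Real.sqrt 2 * κ₂ * e))) +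
              2 * Real.sqrt 2 * κ₂ * (Real.sqrt (∫ x, torusVorticityTensor (L (CascadeParams.tStart j + CascadeParams.tHalf j)) 0 1 x ^ 2) + P.γ * (lam₀ + (2 * Real.sqrt (2 * Real.pi) * ((P.N j : ℝ) / P.δ j)) * e)) +
              2 * κ₃ * e))) +
        P.γ * (2 * Real.sqrt (2 * Real.pi) * ((P.N j : ℝ) / P.δ j)) * (Real.sqrt (∫ x, (Torus.partialDeriv 1 (torusVorticityTensor (L (CascadeParams.tStart j + CascadeParams.tHalf j)) 0 1) x) ^ 2) +
          P.γ * (lam₁ + 2 * ((2 * Real.sqrt (2 * Real.pi) * ((P.N j : ℝ) / P.δ j)) * (Real.sqrt (∫ x, torusVorticityTensor (L (CascadeParams.tStart j + CascadeParams.tHalf j)) 0 1 x ^ 2) + P.γ * (lam₀ + (2 * Real.sqrt (2 * Real.pi) * ((P.N j : ℝ) / P.δ j)) * e)) +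
            Real.sqrt 2 * κ₂ * e))) := by
  have hγ0 : 0 ≤ P.γ := zero_le_one.trans hγ1
  have hδ : 0 < P.δ j := P.δ_pos hδ₀ hd j
  have hab : CascadeParams.tStart j + CascadeParams.tHalf j < CascadeParams.tStart (j + 1) := by
    rw [CascadeParams.tStart_succ]; linarith [CascadeParams.tHalf_pos j]
  have ha0 : (0 : ℝ) ≤ CascadeParams.tStart j + CascadeParams.tHalf j := by
    linarith [CascadeParams.tStart_nonneg j, CascadeParams.tHalf_pos j]
  have hsub : Icc (CascadeParams.tStart j + CascadeParams.tHalf j) (CascadeParams.tStart (j + 1)) ⊆ Icc 0 T' := fun s hs => ⟨ha0.trans hs.1, hs.2.trans hjT⟩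
  have hu : Torus.IsSmoothSpaceTimeOn (Icc (CascadeParams.tStart j + CascadeParams.tHalf j) (CascadeParams.tStart (j + 1))) P.field :=
    P.isSmoothSpaceTimeOn_field_of_subset_V hδ₀ hd Subset.rfl
  have hudiv : ∀ t ∈ Icc (CascadeParams.tStart j + CascadeParams.tHalf j) (CascadeParams.tStart (j + 1)), Torus.IsDivFree (P.field t) := fun t ht => P.isDivFree_field_of_mem_V ht
  have hw := hL.mono hsub
  have hq' := hq.mono hsub
  have hwdiv : ∀ t ∈ Icc (CascadeParams.tStart j + CascadeParams.tHalf j) (CascadeParams.tStart (j + 1)), Torus.IsDivFree (L t) := fun t ht => hdiv t (hsub ht)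
  have hlin' : ∀ t ∈ Icc (CascadeParams.tStart j + CascadeParams.tHalf j) (CascadeParams.tStart (j + 1)), ∀ x, Torus.timeDerivWithin (Icc (CascadeParams.tStart j + CascadeParams.tHalf j) (CascadeParams.tStart (j + 1))) L t x +
      Torus.convect (P.field t) (L t) x + Torus.convect (L t) (P.field t) x =
        ν • Torus.laplacian (L t) x - Torus.gradient (q t) x + (fun t y => ν • Torus.laplacian (P.field t) y) t x := by
    intro t ht x
    rw [ApproxResponse.timeDerivWithin_Icc_eq_of_subset hab hsub hL ht x]
    exact hlin t (hsub ht) x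
  -- shear structure and caps with `κ₁ = 2√(2π)·(N_j/δ_j)`
  have eκ : P.rateH j t = P.rateH j t := rfl
  have hκ₁0 : 0 ≤ 2 * Real.sqrt (2 * Real.pi) * ((P.N j : ℝ) / P.δ j) := by positivity
  have ek : ∀ r : ℝ, r * (2 * Real.sqrt (2 * Real.pi) * P.N j / P.δ j) =
      r * (2 * Real.sqrt (2 * Real.pi) * ((P.N j : ℝ) / P.δ j)) := fun r => by ring
  have hu0 : ∀ t ∈ Icc (CascadeParams.tStart j + CascadeParams.tHalf j) (CascadeParams.tStart (j + 1)), ∀ x, Torus.partialDeriv 1 (P.field t) x = 0 :=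
    fun t ht x => partialDeriv_one_field_V P ht x
  have hu1 : ∀ t ∈ Icc (CascadeParams.tStart j + CascadeParams.tHalf j) (CascadeParams.tStart (j + 1)), ∀ x (v : EuclideanSpace ℝ (Fin 2)),
      |⟪Torus.partialDeriv 0 (P.field t) x, v⟫_ℝ| ≤ P.rateV j t * |v 1| :=
    fun t ht x v => abs_inner_partialDeriv_zero_field_V P hγ0 hδ ht x v
  have hu2 : ∀ t ∈ Icc (CascadeParams.tStart j + CascadeParams.tHalf j) (CascadeParams.tStart (j + 1)), ∀ x (v : EuclideanSpace ℝ (Fin 2)),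
      |⟪Torus.partialDeriv 0 (Torus.partialDeriv 0 (P.field t)) x, v⟫_ℝ| ≤
        (P.rateV j t * (2 * Real.sqrt (2 * Real.pi) * ((P.N j : ℝ) / P.δ j))) * |v 1| := by
    intro t ht x v
    rw [← ek]
    exact abs_inner_partialDeriv_zero_zero_field_V P hγ0 hδ ht x v
  have hΩg : ∀ t ∈ Icc (CascadeParams.tStart j + CascadeParams.tHalf j) (CascadeParams.tStart (j + 1)), ∀ x,
      ‖Torus.gradient (torusVorticityTensor (P.field t) 0 1) x‖ ≤ P.rateV j t * (2 * Real.sqrt (2 * Real.pi) * ((P.N j : ℝ) / P.δ j)) := by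
    intro t ht x
    rw [← ek]
    exact P.norm_gradient_vorticity_field_le_of_mem_V hγ0 hδ ht (P.abs_deriv_deriv_U_le hδ) x
  have hΩ1 : ∀ t ∈ Icc (CascadeParams.tStart j + CascadeParams.tHalf j) (CascadeParams.tStart (j + 1)), ∀ x m,
      |Torus.partialDeriv m (torusVorticityTensor (P.field t) 0 1) x| ≤ P.rateV j t * (2 * Real.sqrt (2 * Real.pi) * ((P.N j : ℝ) / P.δ j)) := by
    intro t ht x m
    have hΩt : IsSmooth (torusVorticityTensor (P.field t) 0 1) :=
      (isSmoothSpaceTimeOn_torusVorticityTensor hu hab 0 1).isSmooth_slice ht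
    exact (abs_partialDeriv_le_norm_gradient (hΩt.isContDiff (by simp)) x m).trans (hΩg t ht x)
  have hΓ : ∀ t ∈ Icc (CascadeParams.tStart j + CascadeParams.tHalf j) (CascadeParams.tStart (j + 1)), ∫ τ in (CascadeParams.tStart j + CascadeParams.tHalf j)..t, P.rateV j τ ≤ P.γ := fun t ht => P.integral_rateV_le hγ0 ht
  exact response_slot_bounds hab hν hu hudiv hw hq' hwdiv hlin' (k := 1) (k' := 0) (by decide) (P.continuous_rateV j)
    (fun τ _ => P.rateV_nonneg hγ0 j τ) hγ1 hΓ hκ₁0 hκ₂ hκ₃ hl₀ hl₁ hl₂ he0 hu0 hu1 hu2 hΩg hΩ1 hΩ2 hΩ3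
    hc0 hc1 hc2 he ht

end Summit.AnomalousDissipation.AnomalousDissipation.Theorems.SawtoothPulseCascade.LipAgmon

end
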